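import Mathlib
import Summits.MatrixMultiplication.Statement
import Summits.MatrixMultiplication.MatrixMultiplication.Theses.GraphEquations
import Summits.MatrixMultiplication.MatrixMultiplication.Theorems.GraphEquationsPurification
import Summits.MatrixMultiplication.MatrixMultiplication.Theorems.GraphEquationsOrderObstruction
import Summits.MatrixMultiplication.MatrixMultiplication.Theorems.GraphEquationsSquaredSystems
import Summits.MatrixMultiplication.MatrixMultiplication.Theorems.GraphEquationsInitialIdeal
import Summits.MatrixMultiplication.MatrixMultiplication.Theorems.GraphEquationsInitialIdealRung

/-!
# Line «purisplit» for crux `GraphEquations.MultiplicityReduction` (stmt-MatrixMultiplication-27806)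

STAGED by decomp-mm-lens-5 g27 (NOT registered — registration is the writer's call, via the
operator).  Lens 5: finite/base range + asymptotic regime + bridge.

The crux `MultiplicityReduction` (`H_mult`) is, by M12, equivalent to `Purification`
(`multiplicityReduction_iff_purification`).  This line SPLITS `Purification` through the
`I`-adic notion `EqAdmissibleIdealIso β K` (kernel M13, «ideal initially isolated to order `K`»):

* `stub_isolationOrderReduction` (OR′, the BRIDGE from the asymptotic regime «isolation order → ∞»
  to the finite range): `EqAdmissible β → ∀ β' > β, ∃ K, EqAdmissibleIdealIso β' K`;
* `stub_boundedOrderPurification` (BOP′, the FINITE RANGE, a ladder over `K`):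
  `∀ K, EqAdmissibleIdealIso β K → ∀ β' > β, EqAdmissiblePure β'`;
* composition `MultiplicityReduction_of : OR′ → BOP′ → MultiplicityReduction` (kernel-checked,
  through `Purification.multiplicityReduction`, M12).

Sorries: exactly the two `stub_*`.  Everything else is proved: NEC for both stubs from `S`
(`nec_*`), the BASE RUNG `rung_boundedOrderPurification_one` (BOP′ at `K = 1` is a THEOREM, M13b),
`rung_one_iff_red` (order one = the currency of `H_red`), and the WITNESS OF WEAKNESS
`witness_orderReduction_not_free` (W1: at every admissible `β` and every `K` there are admissible
correct families whose test ideals are NOT initially isolated to order `K` over any point — M14b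
squared systems + M13; so OR′ is not implied by admissibility and must LEAVE the given ideal,
radical-ward, cf. M14a).  W2 (BOP′ is not the identity on systems: impure order-2 test ideals,
`{f_21, f_22, f_11, a_11 b_11 f_11 + f_12^2}` at `n = 2`) is on paper in `Lines_purisplit.md`.
-/

set_option linter.dupNamespace false

namespace Summit.MatrixMultiplication.MatrixMultiplication.Cruxes.MultiplicityReduction.Purisplit

open Summit.MatrixMultiplication.MatrixMultiplication.Theorems.GraphEquations
open Summit.MatrixMultiplication.MatrixMultiplication.Theses.GraphEquations (MultiplicityReduction)

/-- **OR′ — ISOLATION-ORDER REDUCTION** (bridge: asymptotic regime → finite range).  From cheap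
correct systems, cheap correct systems whose test IDEAL is initially isolated to SOME bounded
`I`-adic order `K`, uniformly in `n`, at the price of `ε` in the exponent. -/
def IsolationOrderReduction : Prop :=
  ∀ β : ℝ, 2 ≤ β → EqAdmissible β → ∀ β' : ℝ, β < β' → ∃ K : ℕ, EqAdmissibleIdealIso β' K

/-- **BOP′ — BOUNDED-ORDER PURIFICATION** (finite range, a ladder over the order `K`; the rung
`K = 1` is a theorem, `rung_boundedOrderPurification_one`).  Cheap correct systems with test ideal
initially isolated to order `K` ⇒ cheap correct systems with PURE ISOLATED tests. -/
def BoundedOrderPurification : Prop :=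
  ∀ K : ℕ, ∀ β : ℝ, 2 ≤ β → EqAdmissibleIdealIso β K → ∀ β' : ℝ, β < β' → EqAdmissiblePure β'

/-- STUB (OR′). -/
theorem stub_isolationOrderReduction : IsolationOrderReduction := by
  sorry

/-- STUB (BOP′). -/
theorem stub_boundedOrderPurification : BoundedOrderPurification := by
  sorry

/-! ## Composition (kernel-checked, no sorry) -/

/-- OR′ ∧ BOP′ ⇒ `Purification` (midpoint exponent). -/
theorem purification_of (hO : IsolationOrderReduction) (hB : BoundedOrderPurification) :
    Purification := by
  intro β hβ hE β' hββ'
  obtain ⟨K, hK⟩ := hO β hβ hE ((β + β') / 2) (by linarith)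
  exact hB K ((β + β') / 2) (by linarith) hK β' (by linarith)

/-- **The line concludes the crux BY NAME:** OR′ → BOP′ → `GraphEquations.MultiplicityReduction`. -/
theorem MultiplicityReduction_of :
    IsolationOrderReduction → BoundedOrderPurification →
      Summit.MatrixMultiplication.MatrixMultiplication.Theses.GraphEquations.MultiplicityReduction :=
  fun hO hB => (purification_of hO hB).multiplicityReduction

/-- The crux from the two stubs. -/
theorem multiplicityReduction_holds :
    Summit.MatrixMultiplication.MatrixMultiplication.Theses.GraphEquations.MultiplicityReduction :=
  MultiplicityReduction_of stub_isolationOrderReduction stub_boundedOrderPurification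

/-! ## NEC: both stubs follow from `S` -/

/-- `S → OR′` (generator systems: order `1`). -/
theorem nec_isolationOrderReduction (hS : _root_.MatrixMultiplication) : IsolationOrderReduction :=
  fun _ hβ _ _ hββ' => ⟨1, nec_eqAdmissibleIdealIso_one hS (lt_of_le_of_lt hβ hββ')⟩

/-- `S → BOP′`. -/
theorem nec_boundedOrderPurification (hS : _root_.MatrixMultiplication) : BoundedOrderPurification := by
  intro K β hβ _ β' hββ'
  have hω : Literature.Computability.AlgebraicComplexity.omega ℂ = 2 := hS
  have hadm : EqAdmissible ((β + β') / 2) := eqAdmissible_of_omega_lt (by rw [hω]; linarith)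
  exact nec_purification hS ((β + β') / 2) (by linarith) hadm β' (by linarith)

/-! ## The base rung and the witness of weakness (no sorry) -/

/-- **RUNG `K = 1` of BOP′ is a theorem** (M13b). -/
theorem rung_boundedOrderPurification_one :
    ∀ β : ℝ, 2 ≤ β → EqAdmissibleIdealIso β 1 → ∀ β' : ℝ, β < β' → EqAdmissiblePure β' :=
  fun _ _ h _ hββ' => boundedOrderPurification_one h hββ'.le

/-- Order one is exactly the currency of `H_red` (M13b). -/
theorem rung_one_iff_red (β : ℝ) : EqAdmissibleIdealIso β 1 ↔ EqAdmissibleRed β :=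
  eqAdmissibleIdealIso_one_iff_red

/-- **W1 — ORDER REDUCTION IS NOT FREE.**  At every admissible `β` and for every order `K` there
are admissible correct families (the `K`-fold squared systems, M14b) whose test ideals are NOT
initially isolated to order `K` over any point (M13 + M14a): OR′ must change the ideal. -/
theorem witness_orderReduction_not_free {β : ℝ} (h : EqAdmissible β) (K : ℕ) :
    ∃ c : ℝ, ∀ n : ℕ, 1 ≤ n → ∃ E : EqSystem n, E.Correct ∧ (E.cost : ℝ) ≤ c * (n : ℝ) ^ β ∧
      ∀ y, ¬ E.IdealInitIsolatedAt K y := by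
  obtain ⟨c, hc⟩ := eqAdmissibleDeep_of_eqAdmissible h K
  refine ⟨c, fun n hn => ?_⟩
  obtain ⟨E, hE, hdeep, hcost⟩ := hc n hn
  exact ⟨E, hE, hcost, fun y =>
    EqSystem.not_idealInitIsolatedAt_of_tests_mem_pow hn (Nat.lt_two_pow_self) hdeep y⟩

/-- W1, unconditional instance: at `β = 5/2`, for every `K`. -/
theorem witness_orderReduction_not_free_five_halves (K : ℕ) :
    ∃ c : ℝ, ∀ n : ℕ, 1 ≤ n → ∃ E : EqSystem n, E.Correct ∧ (E.cost : ℝ) ≤ c * (n : ℝ) ^ (5 / 2 : ℝ) ∧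
      ∀ y, ¬ E.IdealInitIsolatedAt K y :=
  witness_orderReduction_not_free eqAdmissible_five_halves K

/-- Non-vacuity of OR′'s conclusion at the base rung: `EqAdmissibleIdealIso (5/2) 1` (M13). -/
theorem orderOne_five_halves : EqAdmissibleIdealIso (5 / 2) 1 := eqAdmissibleIdealIso_five_halves

/-! ## Logical position: the crux is EXACTLY the conjunction of the two stubs -/

/-- Forget the isolation datum. -/
theorem eqAdmissible_of_idealIso {β : ℝ} {K : ℕ} (h : EqAdmissibleIdealIso β K) : EqAdmissible β := by
  obtain ⟨c, hc⟩ := h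
  refine ⟨c, fun n hn => ?_⟩
  obtain ⟨E, hE, _, hcost⟩ := hc n hn
  exact ⟨E, hE, hcost⟩

/-- crux ⇒ OR′ (with `K = 1`: reduced = ideal initially isolated to order one, M13b). -/
theorem isolationOrderReduction_of_crux
    (h : Summit.MatrixMultiplication.MatrixMultiplication.Theses.GraphEquations.MultiplicityReduction) :
    IsolationOrderReduction :=
  fun β hβ hE β' hββ' => ⟨1, (rung_one_iff_red β').mpr (h β hβ hE β' hββ')⟩

/-- crux ⇒ BOP′ (forget the isolation datum, apply the crux, reduced ⇒ pure, M9b). -/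
theorem boundedOrderPurification_of_crux
    (h : Summit.MatrixMultiplication.MatrixMultiplication.Theses.GraphEquations.MultiplicityReduction) :
    BoundedOrderPurification :=
  fun _ β hβ hI β' hββ' => eqAdmissiblePure_of_red (h β hβ (eqAdmissible_of_idealIso hI) β' hββ')

/-- **crux ⇔ OR′ ∧ BOP′** — a conjunct split: each stub is a consequence of the crux (so at most as
strong), neither is known to give it back alone (probes P1–P6, folder/bc/purisplit_probes.lean). -/
theorem crux_iff_split :
    Summit.MatrixMultiplication.MatrixMultiplication.Theses.GraphEquations.MultiplicityReduction ↔
      IsolationOrderReduction ∧ BoundedOrderPurification :=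
  ⟨fun h => ⟨isolationOrderReduction_of_crux h, boundedOrderPurification_of_crux h⟩,
    fun h => MultiplicityReduction_of h.1 h.2⟩

end Summit.MatrixMultiplication.MatrixMultiplication.Cruxes.MultiplicityReduction.Purisplit
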